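import Mathlib.GroupTheory.OrderOfElement
import Mathlib.Algebra.BigOperators.Group.Finset.Basic
import Mathlib.Algebra.Order.BigOperators.Ring.Finset
import Mathlib.Algebra.Field.Basic
import HarnessLib

/-!
# Deligne's *Weil I*, Lemma (6.7): families with the same `n`-th powers for many `n` coincide

Deligne, *La conjecture de Weil. I*, Publ. Math. IHÉS 43 (1974), §6 ("Un théorème de
rationalité") proves Théorème (6.2) — rationality of the local characteristic polynomials of
`ℰ₀/(ℰ₀ ∩ ℰ₀^⊥)` for a Lefschetz pencil — from Proposition (6.6) (Chebotarev density and a measure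
argument in `H ⊆ ℤ̂ × CSp`) via the following elementary lemma, which turns "the families `(δ_jⁿ)`
and `(ε_jⁿ)` agree for many `n`" into "the families agree":

> **Lemme (6.7).** Soient `K` un ensemble fini d'entiers `≠ 1` et `(δ_j)_{1 ≤ j ≤ Q}`,
> `(ε_j)_{1 ≤ j ≤ Q}` deux familles d'éléments d'un corps. Si, pour tout `n` assez grand non
> divisible par aucun des `λ ∈ K`, la famille des `δ_jⁿ` coïncide avec celle des `ε_jⁿ` (à l'ordre
> près), alors la famille des `δ_j` coïncide avec celle des `ε_j` (à l'ordre près).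

This file PROVES it (`WeilRationality.multiset_eq_of_map_pow_eq`), families "à l'ordre près" being
`Multiset`s and `K` a finite set of natural numbers not containing `1`, following the printed
proof: induction on `Q`; the set of `n` with `δⁿ = εⁿ` is the set of multiples of some `n(δ, ε)`
(`exists_forall_pow_eq_pow_iff_dvd`; `n(δ, ε) = 1` iff `δ = ε`); if no `ε_j` equals `δ_Q`, an
`n` "arbitrairement grand, non divisible par aucun des `n_j` ni par aucun des `λ ∈ K`"
(`exists_ge_forall_not_dvd`: `n = 1 + n₀ ∏ λ`) contradicts the hypothesis; then remove `δ_Q = ε_{j₀}`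
from both families.

## References

* P. Deligne, *La conjecture de Weil. I*, Publ. Math. IHÉS 43 (1974), 273–307: Lemme (6.7),
  p. 297. [Deligne1974]

## Design notes

* "Entiers `≠ 1`" is read as natural numbers (`K : Finset ℕ`, `1 ∉ K`); `0 ∈ K` is allowed and
  harmless (no positive `n` is divisible by `0`), negative integers would only duplicate their
  absolute values (and `-1` has to be excluded like `1`).
* What is NOT here: (6.6), (6.8)–(6.13) (Chebotarev, Haar measure on the monodromy group) and
  Théorème (6.2) itself, which need the `ℓ`-adic sheaves of §§4–6.
-/

namespace Literature.NumberTheory.LFunctions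

namespace WeilRationality

variable {F : Type*} [Field F]

/-- For `a, e` in a field, `{n | aⁿ = eⁿ}` is the set of multiples of a natural number `m`
("L'ensemble des entiers `n` tels que `δ_Qⁿ = ε_jⁿ` est un idéal `(n_j)`"); `m = 1` iff `a = e`,
and `m = 0` — only `n = 0` — is not excluded. [cite: Deligne1974, proof of Lemme (6.7), p. 297] -/
theorem exists_forall_pow_eq_pow_iff_dvd (a e : F) : ∃ m : ℕ, ∀ n : ℕ, a ^ n = e ^ n ↔ m ∣ n := by
  rcases eq_or_ne e 0 with rfl | he
  · rcases eq_or_ne a 0 with rfl | ha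
    · exact ⟨1, fun n => by simp⟩
    · refine ⟨0, fun n => ?_⟩
      rw [zero_dvd_iff]
      cases n with
      | zero => simp
      | succ n => simp [ha]
  rcases eq_or_ne a 0 with rfl | ha
  · refine ⟨0, fun n => ?_⟩
    rw [zero_dvd_iff]
    cases n with
    | zero => simp
    | succ n => simpa using (pow_ne_zero (n + 1) he).symm
  · refine ⟨orderOf (a / e), fun n => ?_⟩
    rw [orderOf_dvd_iff_pow_eq_one, div_pow, div_eq_one_iff_eq (pow_ne_zero n he)]

/-- For a finite set `S` of natural numbers not containing `1` there are arbitrarily large `n`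
divisible by no element of `S` (`n = n₀ ∏_{λ ∈ S, λ ≠ 0} λ + 1`). [cite: Deligne1974, proof of Lemme (6.7), p. 297] -/
theorem exists_ge_forall_not_dvd (S : Finset ℕ) (hS : 1 ∉ S) (n₀ : ℕ) :
    ∃ n, n₀ ≤ n ∧ ∀ l ∈ S, ¬ l ∣ n := by
  set L := ∏ l ∈ S.erase 0, l with hL
  have hLpos : 0 < L :=
    Finset.prod_pos fun l hl => Nat.pos_of_ne_zero (Finset.ne_of_mem_erase hl)
  refine ⟨n₀ * L + 1, ?_, fun l hl hdvd => ?_⟩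
  · calc n₀ = n₀ * 1 := (mul_one _).symm
      _ ≤ n₀ * L := Nat.mul_le_mul_left _ hLpos
      _ ≤ n₀ * L + 1 := Nat.le_succ _
  · rcases eq_or_ne l 0 with rfl | hl0
    · rw [zero_dvd_iff] at hdvd; omega
    · have hlL : l ∣ n₀ * L :=
        dvd_mul_of_dvd_right (Finset.dvd_prod_of_mem _ (Finset.mem_erase.2 ⟨hl0, hl⟩)) n₀
      have h1 : l = 1 := Nat.dvd_one.1 ((Nat.dvd_add_right hlL).1 hdvd)
      exact hS (h1 ▸ hl)

/-- **Deligne, Weil I, Lemme (6.7).** Let `K` be a finite set of natural numbers `≠ 1` and `δ`,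
`ε` two finite families (multisets) of elements of a field. If for all `n` large enough
(`n ≥ n₀`) and divisible by no `λ ∈ K` the family of the `δ_jⁿ` coincides with that of the `ε_jⁿ`
(up to order), then the family of the `δ_j` coincides with that of the `ε_j` (up to order).
[cite: Deligne1974, Lemme (6.7), p. 297] -/
theorem multiset_eq_of_map_pow_eq (K : Finset ℕ) (hK : 1 ∉ K) {n₀ : ℕ} {δ ε : Multiset F}
    (H : ∀ n, n₀ ≤ n → (∀ l ∈ K, ¬ l ∣ n) → δ.map (· ^ n) = ε.map (· ^ n)) : δ = ε := by
  classical
  induction δ using Multiset.induction_on generalizing ε with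
  | empty =>
    obtain ⟨n, hn, hnd⟩ := exists_ge_forall_not_dvd K hK n₀
    have h := H n hn hnd
    rw [Multiset.map_zero, eq_comm, Multiset.map_eq_zero] at h
    exact h.symm
  | cons a δ ih =>
    choose m hm using fun e : F => exists_forall_pow_eq_pow_iff_dvd a e
    -- some `e₀ ∈ ε` equals `a`: otherwise all `n(a, e) ≠ 1` and a large `n` prime to them and to
    -- `K` gives `aⁿ ∉ {εⁿ}`, contradicting the hypothesis
    obtain ⟨e₀, he₀, hae₀⟩ : ∃ e₀ ∈ ε, a = e₀ := by
      by_contra hne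
      push Not at hne
      have h1 : 1 ∉ K ∪ (ε.map m).toFinset := by
        rw [Finset.mem_union, not_or]
        refine ⟨hK, fun h => ?_⟩
        obtain ⟨e, he, hme⟩ := Multiset.mem_map.1 (Multiset.mem_toFinset.1 h)
        have hae : a = e := by simpa using (hm e 1).2 (hme.symm ▸ dvd_refl (m e))
        exact hne e he hae
      obtain ⟨n, hn, hnd⟩ := exists_ge_forall_not_dvd _ h1 n₀
      have h := H n hn fun l hl => hnd l (Finset.mem_union_left _ hl)
      have ha : a ^ n ∈ ε.map (· ^ n) := by
        rw [← h]; exact Multiset.mem_map_of_mem _ (Multiset.mem_cons_self a δ)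
      obtain ⟨e, he, hea⟩ := Multiset.mem_map.1 ha
      exact hnd (m e) (Finset.mem_union_right _
        (Multiset.mem_toFinset.2 (Multiset.mem_map_of_mem m he))) ((hm e n).1 hea.symm)
    subst hae₀
    -- remove `a = ε_{j₀}` from both families and apply the induction hypothesis
    have h' : δ = ε.erase a := by
      refine ih fun n hn hnd => ?_
      have h := H n hn hnd
      rw [Multiset.map_cons] at h
      rw [Multiset.map_erase_of_mem _ _ he₀, ← h, Multiset.erase_cons_head]
    rw [h', Multiset.cons_erase he₀]

end WeilRationality

end Literature.NumberTheory.LFunctions
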